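import Literature.AlgebraicGeometry.GroupSchemes.UnitComponentKernelIdeal                  -- ★ p846069 (D7 FILE A): `I₀ = ker Γ(j𝒰) = (1 − e)`, Hopf, free quotient, stable
import Literature.RingTheory.Flat.CanonicalLineOfUnitComponentIdeal                       -- ★ p845739 (D4, B-p12): (L1)–(L4)
import Literature.AlgebraicGeometry.GroupSchemes.FrobeniusKernelEqUnitComponentIdeal       -- ★ p846001 (D6, A-p17): ordinary junction `ideal(𝒰_κ) = kerFI`
import Literature.AlgebraicGeometry.GroupSchemes.UnitComponentBaseChange                   -- ★ `isUnitComponent_baseChange`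
import Literature.AlgebraicGeometry.GroupSchemes.AffineGroupSchemeBaseChangeNatural         -- ★ (N) `algBaseChangeEquiv_comap_pullback_map` (+ ★ `algBaseChange(Bialg)Equiv`)
import Literature.AlgebraicGeometry.GroupSchemes.AdmissibleIdealSpecialFibre              -- ★ (D5, B-p18): `spI`, `isHopfIdeal_comap_bialgEquiv`
import Mathlib.LinearAlgebra.TensorProduct.RightExactness
import Mathlib.RingTheory.Ideal.Quotient.Operations
import HarnessLib

/-!
# The canonical line in constructor currency: at an ordinary point there is exactly one admissible generic line specialising to the
# Frobenius kernel — the generic fibre of the unit component ([Serre–Tate 1968] §1; [Katz 1973] 3.1; [Tate 1997] (3.7); [Liu 2021] p. 136)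

Topic `Literature/AlgebraicGeometry/GroupSchemes`; namespace `Literature.AlgebraicGeometry.GroupSchemes.CanonicalLine`.  THEOREMS ONLY; no
definition, no named fact, no instance, no notation, no `sorry`.  Cell `hodgecm-mathlib` (D-0151), P6 «MOD programme», F0P6c-plan (g2) DICT deal
(D7) «(b4′-A) CANONICAL-LINE ASSEMBLY IN CONSTRUCTOR CURRENCY» (2026-09-01 17:23Z; heads «=» 17:27:53Z), FILE B: the `hKb4` binder of
`heart_of_constructors` (`Cruxes/HLiu418/Lines/F0_P6c_DictConstructors.lean` :285) AT ONE POINT, from (D4) ★ `existsUnique_hopfIdeal_closure_le_sup`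
(B-p12), (D5) ★ `spI` ∕ `algBaseChangeEquiv_comap` (B-p18), ★ (N) `algBaseChangeEquiv_comap_pullback_map`, (D6) ★ `FrobKerUnit.*_of_etale` (A-p17) and (D7-A) ★ `UnitComponentIdeal.*`.
HC_CM is proved only modulo the printed citations until rung 0 closes; nothing here is about HC.

THE PRINT.  [SerreTate1968] §1 Lemma 1 ∕ [Katz1973] §3.1 ∕ [Tate1997FiniteFlatGroupSchemes] (3.7): over a henselian valuation ring `R` (fraction field
`K`, residue field `κ`), a finite flat commutative group scheme `𝒢` has the unit component `𝒢⁰ = Spec (A ⧸ I₀)`, `I₀ = (1 − e)`; its generic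
fibre `L₀ = I₀·(K ⊗ A)` (read in `Γ(𝒢_K)`) is «THE CANONICAL LINE»: a closed subgroup of `𝒢_K` of the order of `𝒢⁰`, stable under every
endomorphism, whose closure specialises to `𝒢⁰_κ`; and it is the ONLY closed subgroup of that order whose closure specialises into `𝒢⁰_κ`
(an idempotent in `𝔪·B`, `B` finite free over local `R`, vanishes).  At an ORDINARY point of the P6 heart ([Liu2021] p. 136), `ideal(𝒢⁰_κ)` IS the
Frobenius-kernel ideal `kerFI` (★ (D6)), so: **there is exactly one admissible `L₀ ⊂ Γ(𝒢_K)` with `sp L₀ = kerFI`** — DICT's (b4′) `canonicalLine`.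

MAIN STATEMENTS.  §1 `le_sup_map_maximalIdeal_of_map_includeRight_le` (descent mod `𝔪` for `κ ≅ R⧸𝔪`); §2 `comap_algBaseChangeEquiv_map_includeRight_ker_eq`
(base change of the unit ideal: `e_S⁻¹(I₀·(S ⊗ A)) = ker Γ(j𝒰_S)`, right-exactness + (D5) (N)); §3 `isLocalHom_algebraMap_of_ker_eq`,
`finrank_quotient_ker_comap_unitComponent_eq` (`rk_R (A ⧸ I₀) = q` from the special fibre); §4 HEAD **`existsUnique_admK_spI_eq_kerFI`**.

## References
* [SerreTate1968] J.-P. Serre, J. Tate, *Good reduction of abelian varieties*, Ann. of Math. 88 (1968), §1 Lemma 1.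
* [Katz1973] N. M. Katz, *p-adic properties of modular schemes and modular forms*, LNM 350 (1973), §3.1 (canonical subgroup).
* [Tate1997FiniteFlatGroupSchemes] J. Tate, *Finite flat group schemes* (1997), (3.7).
* [Liu2021] Y. Liu, *Fourier–Jacobi cycles and arithmetic relative trace formula*, Camb. J. Math. 9 (2021), p. 136 (ordinary points, canonical line).
* [EGAIV2] A. Grothendieck, *ÉGA* IV₂, Prop. 2.8.5 (flat closure over a valuation ring).
-/

set_option autoImplicit false

-- Mathlib's `Over`/pull-back APIs are stated across semireducible wrappers (as in the ★ `GroupSchemes/*` files).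
set_option backward.isDefEq.respectTransparency false

-- As in ★ (D6) ∕ (FKw): statements mentioning `relFrobeniusOver` need the slow instance search through the transported structure of the twist.
set_option synthInstance.maxHeartbeats 200000

noncomputable section

universe u

open CategoryTheory CategoryTheory.Limits AlgebraicGeometry MonoidalCategory CartesianMonoidalCategory TensorProduct
open Algebra.TensorProduct (includeRight)
open scoped MonObj Obj

namespace Literature.AlgebraicGeometry.GroupSchemes.CanonicalLine

open Literature.AlgebraicGeometry.Motives (SchemeOver relFrobeniusOver)
open Literature.AlgebraicGeometry.GroupSchemes.AffineGroupScheme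
open Literature.AlgebraicGeometry.GroupSchemes.GroupSchemeKernel (kerι)

/-! ## §1 Descent modulo `𝔪` (`κ ≅ R ⧸ 𝔪`) -/

/-- **DESCENT MODULO `𝔪`**: if `R → κ` is surjective with kernel `𝔪_R` (`κ ≅ R⧸𝔪`) and two ideals `I', I₀ ⊆ A` satisfy
`I₀·(κ ⊗_R A) ⊆ I'·(κ ⊗_R A)`, then `I₀ ⊆ I' + 𝔪A`: read both sides through `κ ⊗_R A → A ⧸ 𝔪A`, `1 ⊗ a ↦ ā`.
[cite: SerreTate1968, §1 Lemma 1] [cite: EGAIV2, Prop. 2.8.5] -/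
theorem le_sup_map_maximalIdeal_of_map_includeRight_le {R κ A : Type*} [CommRing R] [IsLocalRing R] [CommRing κ] [Algebra R κ]
    (hκ : Function.Surjective (algebraMap R κ)) (hker : RingHom.ker (algebraMap R κ) = IsLocalRing.maximalIdeal R)
    [CommRing A] [Algebra R A] (I' I₀ : Ideal A)
    (h : I₀.map (includeRight : A →ₐ[R] κ ⊗[R] A) ≤ I'.map (includeRight : A →ₐ[R] κ ⊗[R] A)) :
    I₀ ≤ I' ⊔ (IsLocalRing.maximalIdeal R).map (algebraMap R A) := by
  set 𝔪A : Ideal A := (IsLocalRing.maximalIdeal R).map (algebraMap R A) with h𝔪A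
  -- `θ₁ : κ → A ⧸ 𝔪A` descending `R → A ⧸ 𝔪A` along the surjection `R ↠ κ`
  have hsurj : Function.Surjective (Algebra.ofId R κ) := hκ
  have hH : RingHom.ker (Algebra.ofId R κ).toRingHom ≤ RingHom.ker (Algebra.ofId R (A ⧸ 𝔪A)).toRingHom := by
    intro r hr
    rw [RingHom.mem_ker] at hr ⊢
    change algebraMap R (A ⧸ 𝔪A) r = 0
    have hr' : r ∈ IsLocalRing.maximalIdeal R := by rw [← hker]; exact hr
    rw [IsScalarTower.algebraMap_apply R A (A ⧸ 𝔪A), Ideal.Quotient.algebraMap_eq, Ideal.Quotient.eq_zero_iff_mem]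
    exact Ideal.mem_map_of_mem _ hr'
  let θ₁ : κ →ₐ[R] A ⧸ 𝔪A := AlgHom.liftOfSurjective (Algebra.ofId R κ) hsurj (Algebra.ofId R (A ⧸ 𝔪A)) hH
  let θ : κ ⊗[R] A →ₐ[R] A ⧸ 𝔪A := Algebra.TensorProduct.lift θ₁ (Ideal.Quotient.mkₐ R 𝔪A) fun _ _ => Commute.all _ _
  have hθ : ∀ a : A, θ (includeRight (R := R) (A := κ) a) = Ideal.Quotient.mk 𝔪A a := fun a => by
    change θ ((1 : κ) ⊗ₜ[R] a) = _
    rw [Algebra.TensorProduct.lift_tmul, map_one, one_mul]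
    rfl
  -- read `h` through `θ`: `I'·(κ ⊗ A)` maps into `I'·(A ⧸ 𝔪A)`
  have hle : I'.map (includeRight : A →ₐ[R] κ ⊗[R] A) ≤ (I'.map (Ideal.Quotient.mk 𝔪A)).comap θ := by
    rw [Ideal.map_le_iff_le_comap]
    intro a ha
    rw [Ideal.mem_comap, Ideal.mem_comap, hθ]
    exact Ideal.mem_map_of_mem _ ha
  intro x hx
  have hx' : θ (includeRight (R := R) (A := κ) x) ∈ I'.map (Ideal.Quotient.mk 𝔪A) :=
    hle (h (Ideal.mem_map_of_mem _ hx))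
  rw [hθ] at hx'
  have hx'' : x ∈ (I'.map (Ideal.Quotient.mk 𝔪A)).comap (Ideal.Quotient.mk 𝔪A) := by
    rw [Ideal.mem_comap]; exact hx'
  rw [Ideal.comap_map_of_surjective _ Ideal.Quotient.mk_surjective, ← RingHom.ker_eq_comap_bot, Ideal.mk_ker] at hx''
  exact hx''

/-! ## §2 Base change of the unit ideal: `e_S⁻¹(I₀·(S ⊗_R A)) = ker Γ(j𝒰_S)` -/

section BaseChange

variable {R : Type u} [CommRing R] (S : Type u) [CommRing S] [Algebra R S] (𝒢 𝒰 : SchemeOver R) [GrpObj 𝒢] [GrpObj 𝒰]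
  [IsAffine 𝒢.left] [IsAffine 𝒰.left] (j𝒰 : 𝒰 ⟶ 𝒢) [IsClosedImmersion j𝒰.left]
  [IsAffine ((Over.pullback (Spec.map (CommRingCat.ofHom (algebraMap R S)))).obj 𝒢).left]
  [IsAffine ((Over.pullback (Spec.map (CommRingCat.ofHom (algebraMap R S)))).obj 𝒰).left]

/-- **BASE CHANGE OF THE UNIT IDEAL.**  For a closed immersion `j𝒰 : 𝒰 ↪ 𝒢` of affine `R`-schemes and an `R`-algebra `S`, the ideal of the base
change `𝒰_S ↪ 𝒢_S`, read in `S ⊗_R Γ(𝒢)` through ★ `algBaseChangeEquiv`, is the extension `I₀·(S ⊗_R Γ(𝒢))` of `I₀ = ker Γ(j𝒰)`: right exactness of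
`S ⊗_R −` (Mathlib `Algebra.TensorProduct.lTensor_ker`) and `Γ(j𝒰_S) = 1 ⊗ Γ(j𝒰)` (★ `algBaseChangeEquiv_comap_pullback_map`).
[cite: EGAIV2, Prop. 2.8.5] [cite: Tate1997FiniteFlatGroupSchemes, (3.7)] -/
theorem comap_algBaseChangeEquiv_map_includeRight_ker_eq :
    ((RingHom.ker (Alg.comap j𝒰).toRingHom : Ideal (Alg 𝒢)).map (includeRight : Alg 𝒢 →ₐ[R] S ⊗[R] Alg 𝒢)).comap
        (algBaseChangeEquiv S 𝒢) =
      (RingHom.ker (Alg.comap ((Over.pullback (Spec.map (CommRingCat.ofHom (algebraMap R S)))).map j𝒰)).toRingHom :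
        Ideal (Alg ((Over.pullback (Spec.map (CommRingCat.ofHom (algebraMap R S)))).obj 𝒢))) := by
  have hsurj : Function.Surjective (Alg.comap j𝒰) := UnitComponentIdeal.surjective_comap 𝒢 𝒰 j𝒰
  -- right exactness: `ker (1 ⊗ Γ(j𝒰)) = I₀·(S ⊗ A)`
  have hker : RingHom.ker (Algebra.TensorProduct.map (AlgHom.id S S) (Alg.comap j𝒰)) =
      (RingHom.ker (Alg.comap j𝒰).toRingHom : Ideal (Alg 𝒢)).map (includeRight : Alg 𝒢 →ₐ[R] S ⊗[R] Alg 𝒢) := by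
    have h := Algebra.TensorProduct.lTensor_ker (A := S) (Alg.comap j𝒰) hsurj
    refine Eq.trans ?_ h
    ext x; exact Iff.rfl
  ext x
  rw [Ideal.mem_comap, RingHom.mem_ker, ← hker, RingHom.mem_ker]
  change _ ↔ Alg.comap ((Over.pullback (Spec.map (CommRingCat.ofHom (algebraMap R S)))).map j𝒰) x = 0
  rw [← (algBaseChangeEquiv S 𝒰).injective.eq_iff, map_zero, algBaseChangeEquiv_comap_pullback_map S j𝒰 x]

end BaseChange

/-! ## §3 The setting of (D7): a henselian valuation ring, residue field `κ ≅ R⧸𝔪`, an affine finite flat group `𝒢`, its unit component `𝒰` -/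

section Setting

variable {R : Type u} [CommRing R] [IsDomain R] [ValuationRing R] [HenselianLocalRing R]
  (K κ : Type u) [Field K] [Algebra R K] [IsFractionRing R K] [Field κ] [Algebra R κ]
  (𝒢 : SchemeOver R) [GrpObj 𝒢] [IsAffine 𝒢.left] [IsFinite 𝒢.hom] [Flat 𝒢.hom]
  [IsAffine ((Over.pullback (Spec.map (CommRingCat.ofHom (algebraMap R K)))).obj 𝒢).left]
  [IsAffine ((Over.pullback (Spec.map (CommRingCat.ofHom (algebraMap R κ)))).obj 𝒢).left]
  (𝒰 : SchemeOver R) [GrpObj 𝒰] [IsAffine 𝒰.left] (j𝒰 : 𝒰 ⟶ 𝒢)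
  [IsAffine ((Over.pullback (Spec.map (CommRingCat.ofHom (algebraMap R κ)))).obj 𝒰).left]

omit [IsDomain R] [ValuationRing R] in
/-- `R → κ` is a LOCAL homomorphism when its kernel is `𝔪_R` (units of `R` are exactly the elements outside `𝔪`). [cite: StacksProject, Tag 07BI] -/
theorem isLocalHom_algebraMap_of_ker_eq (hker : RingHom.ker (algebraMap R κ) = IsLocalRing.maximalIdeal R) :
    IsLocalHom (algebraMap R κ) := by
  refine ⟨fun a ha => ?_⟩
  by_contra hna
  have hmem : a ∈ IsLocalRing.maximalIdeal R := hna
  rw [← hker, RingHom.mem_ker] at hmem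
  exact ha.ne_zero hmem

omit [IsDomain R] [ValuationRing R] in
/-- **`rk_R (Γ(𝒢) ⧸ I₀) = rk_R Γ(𝒰) = q` AT AN ORDINARY POINT**: the rank of the free `R`-module `Γ(𝒰)` is read on the special fibre
(`κ ⊗_R Γ(𝒰) ≅ Γ(𝒰_κ)`, ★ `algBaseChangeEquiv`, Mathlib `Module.finrank_baseChange`), where ★ (D6) `FrobKerUnit.finrank_alg_unitComponent_eq_of_etale`
gives `rk 𝒢⁰_κ = q` from `rk 𝒢_κ = q²`, `rk Ker F = q` and an étale admissible ideal of corank `q`. [cite: Tate1997FiniteFlatGroupSchemes, (3.7)] [cite: Liu2021, p. 136] -/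
theorem finrank_quotient_ker_comap_unitComponent_eq
    (hker : RingHom.ker (algebraMap R κ) = IsLocalRing.maximalIdeal R)
    (h𝒰 : IsMonHom j𝒰 ∧ IsOpenImmersion j𝒰.left ∧ IsClosedImmersion j𝒰.left ∧ ConnectedSpace ↥𝒰.left)
    (p f : ℕ) [Fact p.Prime] [CharP κ p] [ExpChar κ p] [IsAlgClosed κ]
    (hrkG : Module.finrank κ (Alg ((Over.pullback (Spec.map (CommRingCat.ofHom (algebraMap R κ)))).obj 𝒢)) = p ^ f * p ^ f)
    (hrkF : Module.finrank κ (Alg ((Over.pullback (Spec.map (CommRingCat.ofHom (algebraMap R κ)))).obj 𝒢) ⧸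
      (RingHom.ker (kerι (relFrobeniusOver p f ((Over.pullback (Spec.map (CommRingCat.ofHom (algebraMap R κ)))).obj 𝒢))).left.appTop.hom :
        Ideal (Alg ((Over.pullback (Spec.map (CommRingCat.ofHom (algebraMap R κ)))).obj 𝒢)))) = p ^ f)
    (hord : ∃ I : Ideal (Alg ((Over.pullback (Spec.map (CommRingCat.ofHom (algebraMap R κ)))).obj 𝒢)),
      Module.finrank κ (Alg ((Over.pullback (Spec.map (CommRingCat.ofHom (algebraMap R κ)))).obj 𝒢) ⧸ I) = p ^ f ∧
        Etale (Literature.AlgebraicGeometry.Motives.specOver κ (Alg ((Over.pullback (Spec.map (CommRingCat.ofHom (algebraMap R κ)))).obj 𝒢) ⧸ I)).hom) :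
    Module.finrank R (Alg 𝒢 ⧸ (RingHom.ker (Alg.comap j𝒰).toRingHom : Ideal (Alg 𝒢))) = p ^ f := by
  obtain ⟨hjm, hjo, hjc, hconn⟩ := h𝒰
  haveI := hjm
  haveI := isLocalHom_algebraMap_of_ker_eq κ hker
  -- the special fibre `j𝒰_κ : 𝒰_κ ↪ 𝒢_κ` is a unit component (★ `isUnitComponent_baseChange`, `R` henselian, `R → κ` local)
  have hU := isUnitComponent_baseChange (algebraMap R κ) 𝒢 𝒰 j𝒰
  haveI : IsFinite ((Over.pullback (Spec.map (CommRingCat.ofHom (algebraMap R κ)))).obj 𝒢).hom := by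
    change IsFinite (pullback.snd 𝒢.hom (Spec.map (CommRingCat.ofHom (algebraMap R κ)))); infer_instance
  obtain ⟨I, hIq, hIet⟩ := hord
  have hUκ : Module.finrank κ (Alg ((Over.pullback (Spec.map (CommRingCat.ofHom (algebraMap R κ)))).obj 𝒰)) = p ^ f :=
    FrobKerUnit.finrank_alg_unitComponent_eq_of_etale p f _ _ _ hU hrkG hrkF I hIq hIet
  -- `rk_R Γ(𝒰) = rk_κ (κ ⊗ Γ(𝒰)) = rk_κ Γ(𝒰_κ)`
  haveI : Module.Free R (Alg 𝒰) := UnitComponentIdeal.free_alg_unitComponent 𝒢 𝒰 j𝒰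
  haveI : IsFinite 𝒰.hom := (isFinite_and_flat_of_immersions j𝒰).1
  haveI : Module.Finite R (Alg 𝒰) := Alg.moduleFinite 𝒰
  rw [UnitComponentIdeal.finrank_quotient_ker_comap_eq 𝒢 𝒰 j𝒰, ← Module.finrank_baseChange (R := κ) (S := R) (M' := Alg 𝒰),
    ← (algBaseChangeEquiv κ 𝒰).toLinearEquiv.finrank_eq, hUκ]

end Setting

/-! ## §4 HEAD — existence and uniqueness of the canonical line in constructor currency -/

section Head

variable {R : Type u} [CommRing R] [IsDomain R] [ValuationRing R] [HenselianLocalRing R]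
  (K κ : Type u) [Field K] [Algebra R K] [IsFractionRing R K] [Field κ] [Algebra R κ]
  (𝒢 : SchemeOver R) [GrpObj 𝒢] [IsAffine 𝒢.left] [IsFinite 𝒢.hom] [Flat 𝒢.hom]
  [IsAffine ((Over.pullback (Spec.map (CommRingCat.ofHom (algebraMap R K)))).obj 𝒢).left]
  [IsAffine ((Over.pullback (Spec.map (CommRingCat.ofHom (algebraMap R κ)))).obj 𝒢).left]
  {σ : Type*} (β : σ → (𝒢 ⟶ 𝒢))
  (𝒰 : SchemeOver R) [GrpObj 𝒰] [IsAffine 𝒰.left] (j𝒰 : 𝒰 ⟶ 𝒢)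
  [IsAffine ((Over.pullback (Spec.map (CommRingCat.ofHom (algebraMap R κ)))).obj 𝒰).left]

-- Budget: the statement carries P6c's `heart_of_constructors` binders verbatim (`Over.pullback` fibres, `relFrobeniusOver` kernel ideal) and the
-- 60-line assembly elaborates at ≈ 2–3× the default ceiling; no `synthInstance` budget beyond the file-wide one is needed.
set_option maxHeartbeats 800000 in
/-- **THE CANONICAL LINE (EXISTENCE AND UNIQUENESS) IN CONSTRUCTOR CURRENCY** — the `hKb4` binder of P6c's `heart_of_constructors` at ONE point.
SETTING: `R` a henselian valuation ring with fraction field `K` and residue field `κ ≅ R⧸𝔪` (`hκ`, `hker`; ED. 4: `R = 𝒪_Ω̄`), `𝒢 → Spec R` an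
affine finite flat group with an action `β` by homomorphisms, `j𝒰 : 𝒰 ↪ 𝒢` its unit component over `R` (homomorphic open-and-closed immersion,
`𝒰` connected), `p`, `q = p^f` and `κ` algebraically closed of characteristic `p`.  HYPOTHESES (the point is ORDINARY): `rk_κ Γ(𝒢_κ) = q²`, the
Frobenius-kernel ideal `kerFI = ker Γ(ι_{Ker F^f})` has corank `q`, and some `β_κ`-stable Hopf ideal of corank `q` is étale.  CONCLUSION: there is
EXACTLY ONE `L₀ ⊂ Γ(𝒢_K)` which is admissible (`AdmK`: Hopf over `K`, corank `q`, stable under every `Γ(β_K a)`) and specialises to the Frobenius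
kernel (`spI K κ 𝒢 L₀ = kerFI`, ★ (D5) `spI`) — namely the generic fibre of the unit component, `L₀ = e_K⁻¹(I₀·(K ⊗ Γ(𝒢)))`, `I₀ = ker Γ(j𝒰) = (1 − e)`
(★ (D7-A)); existence: (D4) (L1)(L2) + §2 + (D6); uniqueness: (D4) (L3) with `hsp` from §1 + §2 + (D6).
[cite: SerreTate1968, §1 Lemma 1] [cite: Katz1973, §3.1] [cite: Tate1997FiniteFlatGroupSchemes, (3.7)] [cite: Liu2021, p. 136] -/
theorem existsUnique_admK_spI_eq_kerFI
    (hκ : Function.Surjective (algebraMap R κ)) (hker : RingHom.ker (algebraMap R κ) = IsLocalRing.maximalIdeal R)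
    (hβ : ∀ a, IsMonHom (β a))
    (h𝒰 : IsMonHom j𝒰 ∧ IsOpenImmersion j𝒰.left ∧ IsClosedImmersion j𝒰.left ∧ ConnectedSpace ↥𝒰.left)
    (p f : ℕ) [Fact p.Prime] [CharP κ p] [ExpChar κ p] [IsAlgClosed κ]
    (hrkG : Module.finrank κ (Alg ((Over.pullback (Spec.map (CommRingCat.ofHom (algebraMap R κ)))).obj 𝒢)) = p ^ f * p ^ f)
    (hrkF : Module.finrank κ (Alg ((Over.pullback (Spec.map (CommRingCat.ofHom (algebraMap R κ)))).obj 𝒢) ⧸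
      (RingHom.ker (kerι (relFrobeniusOver p f ((Over.pullback (Spec.map (CommRingCat.ofHom (algebraMap R κ)))).obj 𝒢))).left.appTop.hom :
        Ideal (Alg ((Over.pullback (Spec.map (CommRingCat.ofHom (algebraMap R κ)))).obj 𝒢)))) = p ^ f)
    (hord : ∃ I : Ideal (Alg ((Over.pullback (Spec.map (CommRingCat.ofHom (algebraMap R κ)))).obj 𝒢)),
      (I.IsHopfIdeal κ ∧ Module.finrank κ (Alg ((Over.pullback (Spec.map (CommRingCat.ofHom (algebraMap R κ)))).obj 𝒢) ⧸ I) = p ^ f ∧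
        ∀ a, I.map ((Over.pullback (Spec.map (CommRingCat.ofHom (algebraMap R κ)))).map (β a)).left.appTop.hom ≤ I) ∧
        Etale (Literature.AlgebraicGeometry.Motives.specOver κ (Alg ((Over.pullback (Spec.map (CommRingCat.ofHom (algebraMap R κ)))).obj 𝒢) ⧸ I)).hom) :
    ∃ L₀ : Ideal (Alg ((Over.pullback (Spec.map (CommRingCat.ofHom (algebraMap R K)))).obj 𝒢)),
      (L₀.IsHopfIdeal K ∧ Module.finrank K (Alg ((Over.pullback (Spec.map (CommRingCat.ofHom (algebraMap R K)))).obj 𝒢) ⧸ L₀) = p ^ f ∧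
        ∀ a, L₀.map ((Over.pullback (Spec.map (CommRingCat.ofHom (algebraMap R K)))).map (β a)).left.appTop.hom ≤ L₀) ∧
      spI K κ 𝒢 L₀ = (RingHom.ker (kerι (relFrobeniusOver p f
        ((Over.pullback (Spec.map (CommRingCat.ofHom (algebraMap R κ)))).obj 𝒢))).left.appTop.hom : Ideal _) ∧
      ∀ L : Ideal (Alg ((Over.pullback (Spec.map (CommRingCat.ofHom (algebraMap R K)))).obj 𝒢)),
        (L.IsHopfIdeal K ∧ Module.finrank K (Alg ((Over.pullback (Spec.map (CommRingCat.ofHom (algebraMap R K)))).obj 𝒢) ⧸ L) = p ^ f ∧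
          ∀ a, L.map ((Over.pullback (Spec.map (CommRingCat.ofHom (algebraMap R K)))).map (β a)).left.appTop.hom ≤ L) →
        spI K κ 𝒢 L = (RingHom.ker (kerι (relFrobeniusOver p f
          ((Over.pullback (Spec.map (CommRingCat.ofHom (algebraMap R κ)))).obj 𝒢))).left.appTop.hom : Ideal _) → L = L₀ := by
  obtain ⟨hjm, hjo, hjc, hconn⟩ := h𝒰
  haveI := hjm
  haveI : Nonempty ↥(𝟙_ (SchemeOver R)).left := ⟨(IsLocalRing.closedPoint R : PrimeSpectrum R)⟩
  haveI : Module.Finite R (Alg 𝒢) := Alg.moduleFinite 𝒢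
  -- the unit ideal `I₀ = ker Γ(j𝒰) = (1 − e)` over `R` (★ D7-A), Hopf, with free quotient of rank `q`
  set I₀ : Ideal (Alg 𝒢) := RingHom.ker (Alg.comap j𝒰).toRingHom with hI₀def
  obtain ⟨e, he, hI₀⟩ := UnitComponentIdeal.exists_isIdempotentElem_ker_comap_eq_span 𝒢 𝒰 j𝒰
  haveI hI₀H : I₀.IsHopfIdeal R := UnitComponentIdeal.isHopfIdeal_ker_comap 𝒢 𝒰 j𝒰
  haveI : Module.Free R (Alg 𝒢 ⧸ I₀) := UnitComponentIdeal.free_quotient_ker_comap 𝒢 𝒰 j𝒰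
  have hq : Module.finrank R (Alg 𝒢 ⧸ I₀) = p ^ f :=
    finrank_quotient_ker_comap_unitComponent_eq κ 𝒢 𝒰 j𝒰 hker ⟨hjm, hjo, hjc, hconn⟩ p f hrkG hrkF
      (hord.imp fun I hI => ⟨hI.1.2.1, hI.2⟩)
  -- abbreviations (the ★ bialgebra isomorphisms `Γ(𝒢_S) ≅ S ⊗_R Γ(𝒢)` read as ring homomorphisms)
  set eK : Alg ((Over.pullback (Spec.map (CommRingCat.ofHom (algebraMap R K)))).obj 𝒢) →+* K ⊗[R] Alg 𝒢 :=
    (algBaseChangeEquiv K 𝒢).toRingEquiv.toRingHom with heK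
  set eκ : Alg ((Over.pullback (Spec.map (CommRingCat.ofHom (algebraMap R κ)))).obj 𝒢) →+* κ ⊗[R] Alg 𝒢 :=
    (algBaseChangeEquiv κ 𝒢).toRingEquiv.toRingHom with heκ
  set inclK : Alg 𝒢 →ₐ[R] K ⊗[R] Alg 𝒢 := includeRight with hinclK
  set inclκ : Alg 𝒢 →ₐ[R] κ ⊗[R] Alg 𝒢 := includeRight with hinclκ
  set J₀ : Ideal (K ⊗[R] Alg 𝒢) := I₀.map inclK with hJ₀
  set L₀ : Ideal (Alg ((Over.pullback (Spec.map (CommRingCat.ofHom (algebraMap R K)))).obj 𝒢)) := J₀.comap eK with hL₀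
  have heKsurj : Function.Surjective eK := (algBaseChangeEquiv K 𝒢).surjective
  have heκsurj : Function.Surjective eκ := (algBaseChangeEquiv κ 𝒢).surjective
  -- `spI` (★ (D5), written with the bialgebra equivalences) in this currency
  have hspI : ∀ L : Ideal (Alg ((Over.pullback (Spec.map (CommRingCat.ofHom (algebraMap R K)))).obj 𝒢)),
      spI K κ 𝒢 L = (((L.map eK).comap inclK).map inclκ).comap eκ := fun L => rfl
  -- (F2) `eK(L₀) = J₀`, (F3) `J₀ ∩ A = I₀`
  have hF2 : L₀.map eK = J₀ := Ideal.map_comap_of_surjective _ heKsurj _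
  have hF3 : J₀.comap inclK = I₀ := Literature.RingTheory.Flat.comap_map_includeRight_eq (K := K) I₀
  -- the special fibre of the unit ideal is the Frobenius kernel: §2 + (D6)
  haveI := isLocalHom_algebraMap_of_ker_eq κ hker
  have hU := isUnitComponent_baseChange (algebraMap R κ) 𝒢 𝒰 j𝒰
  haveI : IsFinite ((Over.pullback (Spec.map (CommRingCat.ofHom (algebraMap R κ)))).obj 𝒢).hom := by
    change IsFinite (pullback.snd 𝒢.hom (Spec.map (CommRingCat.ofHom (algebraMap R κ)))); infer_instance
  obtain ⟨I, ⟨-, hIq, -⟩, hIet⟩ := hord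
  have hD6 := FrobKerUnit.ker_appTop_unitComponent_eq_ker_appTop_kerι_relFrobeniusOver_of_etale p f
    ((Over.pullback (Spec.map (CommRingCat.ofHom (algebraMap R κ)))).obj 𝒢)
    ((Over.pullback (Spec.map (CommRingCat.ofHom (algebraMap R κ)))).obj 𝒰)
    ((Over.pullback (Spec.map (CommRingCat.ofHom (algebraMap R κ)))).map j𝒰) hU hrkG hrkF I hIq hIet
  have hspκ : (I₀.map inclκ).comap eκ = (RingHom.ker (kerι (relFrobeniusOver p f
      ((Over.pullback (Spec.map (CommRingCat.ofHom (algebraMap R κ)))).obj 𝒢))).left.appTop.hom : Ideal _) := by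
    rw [← hD6]
    exact comap_algBaseChangeEquiv_map_includeRight_ker_eq κ 𝒢 𝒰 j𝒰
  have hspL₀ : spI K κ 𝒢 L₀ = (RingHom.ker (kerι (relFrobeniusOver p f
      ((Over.pullback (Spec.map (CommRingCat.ofHom (algebraMap R κ)))).obj 𝒢))).left.appTop.hom : Ideal _) := by
    rw [← hspκ, hspI, hF2, hF3]
  refine ⟨L₀, ⟨?_, ?_, fun a => ?_⟩, hspL₀, fun L hL hspL => ?_⟩
  · -- Hopf over `K`: transport of (L1) along the bialgebra isomorphism `Γ(𝒢_K) ≅ K ⊗ Γ(𝒢)`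
    have h := AffineGroupScheme.isHopfIdeal_comap_bialgEquiv (algBaseChangeBialgEquiv K 𝒢)
      (Literature.RingTheory.Flat.isHopfIdeal_and_finrank_map_includeRight (K := K) I₀).1
    exact h
  · -- corank `q`
    rw [(Ideal.quotientEquivAlg L₀ J₀ (algBaseChangeEquiv K 𝒢) hF2.symm).toLinearEquiv.finrank_eq,
      (Literature.RingTheory.Flat.isHopfIdeal_and_finrank_map_includeRight (K := K) I₀).2, hq]
  · -- stability under `Γ(β_K a) = 1 ⊗ Γ(β a)` (★ `algBaseChangeEquiv_comap_pullback_map`), from stability of `I₀` under `Γ(β a)` (★ D7-A) and (L1)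
    haveI := hβ a
    rw [Ideal.map_le_iff_le_comap]
    intro x hx
    rw [Ideal.mem_comap, hL₀, Ideal.mem_comap]
    have hx' : eK x ∈ J₀ := by rw [hL₀] at hx; exact hx
    change algBaseChangeEquiv K 𝒢 (Alg.comap ((Over.pullback (Spec.map (CommRingCat.ofHom (algebraMap R K)))).map (β a)) x) ∈ J₀
    rw [algBaseChangeEquiv_comap_pullback_map K (β a) x]
    exact Literature.RingTheory.Flat.map_map_includeRight_le (K := K) I₀ (Alg.comap (β a))
      (UnitComponentIdeal.map_ker_comap_le_of_hom 𝒢 𝒰 j𝒰 (β a)) (Ideal.mem_map_of_mem _ hx')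
  · -- uniqueness: (D4) (L3) with `hsp` read off `spI L = kerFI = spI L₀` by descent mod `𝔪` (§1)
    obtain ⟨hLH, hLq, -⟩ := hL
    obtain ⟨J, hJ⟩ : ∃ J : Ideal (K ⊗[R] Alg 𝒢), J = L.map eK := ⟨_, rfl⟩
    haveI : J.IsHopfIdeal K := by
      have hJc : J = L.comap (algBaseChangeBialgEquiv K 𝒢).symm := by
        rw [hJ]
        ext y
        rw [Ideal.mem_comap, Ideal.mem_map_iff_of_surjective _ heKsurj]
        constructor
        · rintro ⟨x, hx, rfl⟩
          have hsx : (algBaseChangeBialgEquiv K 𝒢).symm (eK x) = x := (algBaseChangeEquiv K 𝒢).symm_apply_apply x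
          rw [hsx]; exact hx
        · intro hy
          exact ⟨_, hy, (algBaseChangeEquiv K 𝒢).apply_symm_apply y⟩
      rw [hJc]
      exact AffineGroupScheme.isHopfIdeal_comap_bialgEquiv (algBaseChangeBialgEquiv K 𝒢).symm hLH
    have hLJ : L = J.comap eK := by
      rw [hJ]
      exact (Ideal.comap_map_of_bijective eK (show Function.Bijective eK from (algBaseChangeEquiv K 𝒢).bijective)).symm
    have hr : Module.finrank K ((K ⊗[R] Alg 𝒢) ⧸ J) = Module.finrank R (Alg 𝒢 ⧸ I₀) := by
      rw [← (Ideal.quotientEquivAlg L J (algBaseChangeEquiv K 𝒢) hJ).toLinearEquiv.finrank_eq, hLq, hq]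
    -- `(J ∩ A)·(κ ⊗ A) = I₀·(κ ⊗ A)`: both pull back under `eκ` to `kerFI`
    have hspJ : ((J.comap inclK).map inclκ).comap eκ = (I₀.map inclκ).comap eκ := by
      rw [hspκ, ← hspL, hspI, hJ]
    have hmapeq : (J.comap inclK).map inclκ = I₀.map inclκ := Ideal.comap_injective_of_surjective _ heκsurj hspJ
    have hsp : I₀ ≤ J.comap inclK ⊔ (IsLocalRing.maximalIdeal R).map (algebraMap R (Alg 𝒢)) :=
      le_sup_map_maximalIdeal_of_map_includeRight_le hκ hker (J.comap inclK) I₀ hmapeq.ge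
    have hL3 := Literature.RingTheory.Flat.comap_includeRight_eq_of_le_sup_maximalIdeal (K := K) he I₀ hI₀ J hr hsp
    rw [hLJ, hL3.2]

end Head

end Literature.AlgebraicGeometry.GroupSchemes.CanonicalLine

end
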